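import Summits.BirchSwinnertonDyer.BirchSwinnertonDyer.Theorems.ManinLocalTwoThreeEtaUnitCubeIffThreeHolds
import Summits.BirchSwinnertonDyer.Rank1Residual.ManinAdditive.CuspidalKummerClass
import Literature.RingTheory.FormalGroups.DworkFrobeniusLift
import Mathlib.RingTheory.PowerSeries.Ideal
import Mathlib.RingTheory.Polynomial.RationalRoot
import HarnessLib

/-!
# E-an-58 ⟸ E-an-55: the `p = 3` cuspidal-Kummer certificate reduces to the cube row alone

Summit `BirchSwinnertonDyer`, route `ManinLocalTwoThree` (cell bsd-f2-manin), crux C3 `ManinPrimeToThreeAtNine`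
(stmt-BirchSwinnertonDyer-22968), reducible residual of the line `kato_shift_three`.  MEMO-an §56.7/§56.12 typed the
`p = 3` twin of the cuspidal Kummer certificate (leaf `…ManinAdditive.CuspidalKummerClass`, namespace
`CuspidalKummerThree`): E-an-58 `ManinPrimeToThreeOfEtaExponent` «= E-an-55 + E-an-56 + UFD step».  E-an-56
(`EtaUnitCubeIffThree`) is a tree theorem (`etaUnitCubeIffThree_holds`); here the UFD step is proved, so that

  `maninPrimeToThreeOfEtaExponent_of_maninThreeKummerCube : ManinThreeKummerCube → ManinPrimeToThreeOfEtaExponent`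

— the certificate at `9 ∣ N` hinges on E-an-55 `ManinThreeKummerCube` ALONE (Honda (III) at the additive prime `3`
plus the tripling identity `f_T∘[3] = (−1/27)·g³`; open in the tree).  Tools (general exponent `k`, reused verbatim
from the `p = 2` file `ManinLocalTwoThreeManinOddOfOddEtaExponent` where `k = 2`):

* `exists_eq_pow_of_mul_pow_eq_pow` — in an integrally closed domain, `g·Fᵏ = Gᵏ`, `F ≠ 0`, `k > 0 ⇒ g = hᵏ`;
* `exists_mul_pow_eq_pow_of_X_pow` — in `R⟦X⟧` (domain), `Xᵃ·g·Fᵏ = Xᵇ·Gᵏ` with `g(0)` a unit ⇒ `g·F′ᵏ = G′ᵏ`,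
  `F′ ≠ 0` (compare `X`-orders);
* `ℤ₃⟦q⟧` is factorial (Mathlib: `R⟦X⟧` is a UFD for a PID `R`), hence integrally closed.

Nothing about BSD, Manin's conjecture, or any Manin constant is asserted; E-an-55 is an explicit hypothesis.
-/

set_option autoImplicit false
set_option linter.dupNamespace false

noncomputable section

open scoped Classical
open PowerSeries WeierstrassCurve Literature.NumberTheory.EllipticCurves Literature.NumberTheory.EllipticCurves.ModularForms
  Literature.RingTheory.FormalGroups
open Summit.BirchSwinnertonDyer.Rank1Residual.ManinAdditive.CuspidalKummer
  Summit.BirchSwinnertonDyer.Rank1Residual.ManinAdditive.CuspidalKummerThree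

namespace Summit.BirchSwinnertonDyer.BirchSwinnertonDyer.Theorems.ManinLocalTwoThree

/-- **UFD step, exponent `k`.** In an integrally closed domain, `g·Fᵏ = Gᵏ` with `F ≠ 0` and `k > 0` forces
`g = hᵏ` (`G/F` is integral, being a `k`-th root of `g`). [folklore] -/
theorem exists_eq_pow_of_mul_pow_eq_pow {R : Type*} [CommRing R] [IsDomain R] [IsIntegrallyClosed R]
    {g F G : R} {k : ℕ} (hk : 0 < k) (hF : F ≠ 0) (h : g * F ^ k = G ^ k) : ∃ h : R, g = h ^ k := by
  let K := FractionRing R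
  have hFK : algebraMap R K F ≠ 0 :=
    fun h0 => hF (IsFractionRing.injective R K (by rw [h0, map_zero]))
  set ρ : K := algebraMap R K G / algebraMap R K F with hρ
  have hρk : ρ ^ k = algebraMap R K g := by
    have h' := congrArg (algebraMap R K) h
    rw [map_mul, map_pow, map_pow] at h'
    rw [hρ, div_pow, div_eq_iff (pow_ne_zero k hFK), ← h', mul_comm]
  have hint : IsIntegral R ρ := IsIntegral.of_pow hk (by rw [hρk]; exact isIntegral_algebraMap)
  obtain ⟨h₀, hh₀⟩ := IsIntegrallyClosed.algebraMap_eq_of_integral hint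
  refine ⟨h₀, IsFractionRing.injective R K ?_⟩
  rw [map_pow, hh₀, hρk]

/-- Order bookkeeping, exponent `k`: from `Xᵃ·g·Fᵏ = Xᵇ·Gᵏ` in a power-series domain with `g(0)` a unit
and `F, G ≠ 0` one gets `g·F′ᵏ = G′ᵏ` with `F′ ≠ 0` (`a ≡ b (mod k)`; move the power of `X` into the `k`-th
power). [folklore] -/
theorem exists_mul_pow_eq_pow_of_X_pow {R : Type*} [CommRing R] [IsDomain R] {g F G : R⟦X⟧} {a b k : ℕ}
    (hk : 0 < k) (hg : IsUnit g) (hF : F ≠ 0) (hG : G ≠ 0) (h : X ^ a * g * F ^ k = X ^ b * G ^ k) :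
    ∃ F' G' : R⟦X⟧, F' ≠ 0 ∧ g * F' ^ k = G' ^ k := by
  have hord := congrArg PowerSeries.order h
  rw [order_mul, order_mul, order_X_pow, order_zero_of_unit hg, add_zero, order_pow, order_mul,
    order_X_pow, order_pow, ← coe_toNat_order hF, ← coe_toNat_order hG] at hord
  set kF := F.order.toNat
  set kG := G.order.toNat
  have hnat : a + k * kF = b + k * kG := by
    have : ((a + k * kF : ℕ) : ℕ∞) = ((b + k * kG : ℕ) : ℕ∞) := by
      push_cast
      simpa [smul_eq_mul] using hord
    exact_mod_cast this
  have hX : ∀ n : ℕ, (X : R⟦X⟧) ^ n ≠ 0 := fun n => pow_ne_zero n X_ne_zero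
  have _ := hk
  rcases le_total a b with hab | hab
  · obtain ⟨d, rfl⟩ := Nat.exists_eq_add_of_le hab
    have hdvd : k ∣ d := by
      have h1 : k ∣ d + k * kG := ⟨kF, by linarith⟩
      exact (Nat.dvd_add_left (dvd_mul_right k kG)).mp h1
    obtain ⟨m, rfl⟩ := hdvd
    refine ⟨F, X ^ m * G, hF, ?_⟩
    have h' : X ^ a * (g * F ^ k) = X ^ a * ((X ^ m * G) ^ k) := by
      rw [← mul_assoc, h, pow_add, pow_mul]; ring
    exact mul_left_cancel₀ (hX a) h'
  · obtain ⟨d, rfl⟩ := Nat.exists_eq_add_of_le hab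
    have hdvd : k ∣ d := by
      have h1 : k ∣ d + k * kF := ⟨kG, by linarith⟩
      exact (Nat.dvd_add_left (dvd_mul_right k kF)).mp h1
    obtain ⟨m, rfl⟩ := hdvd
    refine ⟨X ^ m * F, G, mul_ne_zero (hX m) hF, ?_⟩
    have h' : X ^ b * (g * (X ^ m * F) ^ k) = X ^ b * G ^ k := by
      rw [← h, pow_add, pow_mul]; ring
    exact mul_left_cancel₀ (hX b) h'

/-- `z³·y(z)` has constant term `−1`. [Silverman AEC IV.1] [folklore] -/
theorem constantCoeff_formalYMulCube' {R : Type*} [CommRing R] (W : WeierstrassCurve R) :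
    constantCoeff W.formalYMulCube = -1 := by
  rw [formalYMulCube, map_neg, constantCoeff_invOfUnit, inv_one, Units.val_one]

/-- **E-an-58 from E-an-55 (the `p = 3` certificate modulo the cube row).**  Granting E-an-55
`ManinThreeKummerCube` (`9 ∣ N ∧ 3 ∣ c ⇒ Θ_T` is a cube in `Frac ℤ₃⟦q⟧`), a cuspidal Kummer cube representative
`(r, g, A, B)` of `Θ_T` with some `r_δ ≢ 0 (mod 3)` forces `3 ∤ c`: `Θ·B′³ = A′³` and `Θ·B³·qⁿ¹ = qⁿ²·g·A³` give
`qⁿ²·g·(AB′)³ = qⁿ¹·(A′B)³` in `ℤ₃⟦q⟧` (`A ≠ 0` as `Θ(0) = −1`), so `g` is a cube in `ℤ₃⟦q⟧` (orders + UFD step),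
so `3 ∣ r_δ` for all `δ` by E-an-56 (`etaUnitCubeIffThree_holds`). Nothing about BSD or Manin's conjecture is
asserted; E-an-55 is an explicit hypothesis. [folklore] -/
theorem maninPrimeToThreeOfEtaExponent_of_maninThreeKummerCube (h55 : ManinThreeKummerCube) :
    ManinPrimeToThreeOfEtaExponent := by
  intro W hWell hWmin N hN D a ha h9 X₀ Y₀ hT z hz r g A B hrep hndvd h3c
  obtain ⟨-, hEta, hB0, -, n₁, n₂, -, hEq⟩ := hrep
  obtain ⟨A', B', hB', hcube⟩ := h55 W D a ha h9 X₀ Y₀ hT z hz h3c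
  set Θ := kummerCubeSeries W D.c X₀ Y₀ z with hΘ
  have hcompat : ∀ P : ℤ⟦X⟧, PowerSeries.map (Rat.castHom ℚ_[3]) (PowerSeries.map (Int.castRingHom ℚ) P) =
      PowerSeries.map PadicInt.Coe.ringHom (PowerSeries.map (Int.castRingHom ℤ_[3]) P) := fun P => by
    rw [map_map_apply, map_map_apply,
      Subsingleton.elim ((Rat.castHom ℚ_[3]).comp (Int.castRingHom ℚ))
        ((PadicInt.Coe.ringHom (p := 3)).comp (Int.castRingHom ℤ_[3]))]
  have hκinj : Function.Injective (PowerSeries.map (PadicInt.Coe.ringHom (p := 3))) :=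
    PowerSeries.map_injective _ (fun x y h => PadicInt.ext h)
  have hιQinj : Function.Injective (PowerSeries.map (Int.castRingHom ℚ)) :=
    PowerSeries.map_injective _ (RingHom.injective_int _)
  have hιZinj : Function.Injective (PowerSeries.map (Int.castRingHom ℤ_[3])) :=
    PowerSeries.map_injective _ (RingHom.injective_int _)
  -- `Θ ≠ 0` (constant term `−1`), hence `A ≠ 0`
  have hz0 : constantCoeff z = 0 := hz.1
  have hΘ0 : constantCoeff Θ = -1 := by
    rw [hΘ, kummerCubeSeries, map_sub, map_sub,
      Literature.RingTheory.FormalGroups.constantCoeff_subst_of_constantCoeff_eq_zero hz0,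
      constantCoeff_formalYMulCube', smul_eq_C_mul, smul_eq_C_mul, smul_eq_C_mul, map_mul, map_pow, hz0,
      map_mul, map_sub, map_mul, map_mul, map_pow, hz0]
    simp
  have hΘne : Θ ≠ 0 := fun h => by rw [h, map_zero] at hΘ0; norm_num at hΘ0
  have hAne : A ≠ 0 := by
    intro hA
    rw [hA] at hEq
    simp only [zero_pow three_ne_zero, mul_zero, map_zero] at hEq
    rcases mul_eq_zero.mp hEq with h | h
    · rcases mul_eq_zero.mp h with h | h
      · exact hΘne h
      · exact hB0 (hιQinj (by rw [map_zero]; exact (pow_eq_zero_iff three_ne_zero).mp h))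
    · exact X_ne_zero ((pow_eq_zero_iff' ).mp h).1
  -- the equation in `ℤ₃⟦X⟧`
  set gZ : ℤ_[3]⟦X⟧ := PowerSeries.map (Int.castRingHom ℤ_[3]) g with hgZ
  set AZ : ℤ_[3]⟦X⟧ := PowerSeries.map (Int.castRingHom ℤ_[3]) A with hAZ
  set BZ : ℤ_[3]⟦X⟧ := PowerSeries.map (Int.castRingHom ℤ_[3]) B with hBZ
  have hE1 : PowerSeries.map (Rat.castHom ℚ_[3]) Θ * PowerSeries.map PadicInt.Coe.ringHom BZ ^ 3 * X ^ n₁ =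
      X ^ n₂ * PowerSeries.map PadicInt.Coe.ringHom gZ * PowerSeries.map PadicInt.Coe.ringHom AZ ^ 3 := by
    have h := congrArg (PowerSeries.map (Rat.castHom ℚ_[3])) hEq
    simp only [map_mul, map_pow, PowerSeries.map_X, hcompat] at h
    exact h
  have hR : X ^ n₂ * gZ * (AZ * B') ^ 3 = X ^ n₁ * (A' * BZ) ^ 3 := by
    apply hκinj
    simp only [map_mul, map_pow, PowerSeries.map_X]
    linear_combination (-(PowerSeries.map PadicInt.Coe.ringHom B') ^ 3) * hE1 +
      X ^ n₁ * (PowerSeries.map PadicInt.Coe.ringHom BZ) ^ 3 * hcube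
  have hgU : IsUnit gZ := by
    rw [isUnit_iff_constantCoeff, hgZ, ← coeff_zero_eq_constantCoeff, coeff_map,
      coeff_zero_eq_constantCoeff, hEta.1, map_one]
    exact isUnit_one
  have hFne : AZ * B' ≠ 0 :=
    mul_ne_zero (fun h => hAne (hιZinj (by rw [map_zero]; exact h))) hB'
  have hGne : A' * BZ ≠ 0 := by
    intro h0
    rw [h0, zero_pow three_ne_zero, mul_zero] at hR
    exact (mul_ne_zero (mul_ne_zero (pow_ne_zero _ X_ne_zero) hgU.ne_zero) (pow_ne_zero 3 hFne)) hR
  obtain ⟨F', G', hF', h'⟩ := exists_mul_pow_eq_pow_of_X_pow three_pos hgU hFne hGne hR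
  obtain ⟨hc, hhc⟩ := exists_eq_pow_of_mul_pow_eq_pow three_pos hF' h'
  -- E-an-56: all exponents are divisible by `3` — contradiction
  have h0 : (0 : ℕ) ∉ N.divisors := fun h =>
    (NeZero.ne N) (Nat.eq_zero_of_zero_dvd (Nat.mem_divisors.mp h).1)
  have hall := (etaUnitCubeIffThree_holds N.divisors r g h0 hEta).mp ⟨hc, hhc⟩
  obtain ⟨δ, hδ, hδn⟩ := hndvd
  exact hδn (hall δ hδ)

end Summit.BirchSwinnertonDyer.BirchSwinnertonDyer.Theorems.ManinLocalTwoThree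

end
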